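import Summits.HodgeConjecture.HodgeConjecture.Theorems.Ring2HypothesesDescentFiniteEtaleBaseChangeRows
import Summits.HodgeConjecture.HodgeConjecture.Theorems.Ring2AbelianAllAndreWeightGysinSupport
import Summits.HodgeConjecture.HodgeConjecture.Theorems.Ring2AbelianAllAndreFibreInvariantPairing
import Summits.HodgeConjecture.HodgeConjecture.Theorems.Ring2AbelianAllAndreTransportLatticeCM
import Summits.HodgeConjecture.HodgeConjecture.Theorems.Ring2AbelianAllAndreDominatedPencils
import HarnessLib

/-!
# Ring 2 · sub-cell AbelianAll (ALL ABELIAN VARIETIES), André axis, part XXXV-c — FINITE ÉTALE BASE CHANGE: the lift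
# `(L)_t(p)` and the transport of a compact pencil of abelian varieties `f : 𝒳 ⟶ S` DESCEND from the pulled-back pencil
# `f' : 𝒳 ×_S S' ⟶ S'` along every finite étale cover `g : S' ⟶ S` with `S'(ℂ)` connected — the lift at `t'` upstairs gives
# the lift at `g(t')` downstairs; so do the every-point lift, the CM-pointed lift and transport. The engine is PURITY ALONG
# THE FINITE FIBRE `g⁻¹(t)`: the push-forward `G_*` along `G : 𝒳 ×_S S' ⟶ 𝒳` of a class dying on the fibres of `f'` dies on
# the fibres of `f` (Poincaré duality transposes `G_*` into `G^*`, and `G^* j_{t*} α` lands in the span of the Gysin images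
# of the finitely many fibres over `g⁻¹(t)`, by Thom–Gysin purity and Mayer–Vietoris — part XXV-e's method). FACT-FREE

HONEST FRAMING (page 1, verbatim): **research route, not a corollary; conditional on HC_CM plus one named
minimal statement.** Cell line: research route conditional on HC_CM; not a corollary; Q11.4-sentence-2 already
refuted in dim ≥ 3. Nothing in this file proves a case of the Hodge conjecture for an abelian variety; `HC_CM`, `HC_AV`
do not occur; no node is born (0 `def`), no named fact is used, no `sorry`; axioms standard; nothing is claimed minimal.

## What this part does (the third functoriality of the André axis, after retracts XXXIII-a and isogenies XXXIII-e/XXXIV/XXXV-a)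

André («il est loisible de remplacer S par un revêtement fini étale», §5.3 p. 30) and every monodromy argument of the
β-column pass freely to a finite étale cover of the base; seat b05 proved that node X = `B⋆` of the total space DESCENDS
from the cover (`standardConjectureBStar_of_familyPullback`) and that compact abelian pencils pull back to compact abelian
pencils (`isCompactAbelianPencil_familyPullback_snd`). This file proves the same DESCENT for the André-axis statements:

* §1 `mem_of_restrictCompl_preimage_eq_zero_of_gysin_mem` — **PURITY ALONG FINITELY MANY FIBRES** (part XXV-e's argument,
  stated for an arbitrary submodule): on a compact abelian pencil, a class of the total space dying off `f⁻¹T`, `T ⊊ S`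
  Zariski-closed, lies in any submodule containing the Gysin images of all fibres (Thom–Gysin for one fibre,
  Mayer–Vietoris over the disjoint finitely many).
* §2 the base change `G : 𝒳 ×_S S' ⟶ 𝒳`, `f' : 𝒳 ×_S S' ⟶ S'`: `G` is surjective (finite étale covers of the irreducible
  base are onto), `G⁻¹(𝒳_t) = f'⁻¹(g⁻¹ t)`, `g⁻¹ t ⊊ S'`, and **`map_fiberι_complexGysin_fst_eq_zero`** — THE ENGINE: a class
  `κ'` on `𝒳 ×_S S'` dying on the fibres of `f'` has `G_* κ'` dying on the fibres of `f` (duality: `⟨j_{t*} α, G_* κ'⟩ =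
  ± ⟨κ', G^* j_{t*} α⟩`, and `G^* j_{t*} α` dies off `f'⁻¹(g⁻¹ t)`, hence is a sum of Gysin images of fibres of `f'`, each
  orthogonal to `κ'`).
* §3–§4 (the ROWS: the lift, the every-point / CM-pointed lift, transport and its every-point / CM-pointed forms DESCEND
  from the pulled-back pencil) are in the companion file `Ring2AbelianAllAndreBaseChangePencilsNodes` (part XXXV-d), which
  only assembles §2 with the degree trick `G_* G^* = c • id` and the fibre identifications.

What is NOT claimed: the ASCENT (lift / transport for `f` ⟹ for `f'`): upstairs the monodromy group is a finite-index
SUBGROUP, so `Im j'^*_{t'} ⊋ Im j_t^*` in general — more invariant classes are asked to lift, and nothing here (or in print)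
derives that from downstairs; any flatness / degree statement for `G` beyond `G_* G^* = c • id`, `c ≠ 0`; anything minimal;
any case of HC; any node-level statement (the nodes quantify over all pencils, a class stable under base change, and gain
nothing). EDGE LABELS: every row K (kernel, fact-free).

References: Andre1996Motifs (§5.3 p. 30 «remplacer S par un revêtement fini étale»; §5.1 p. 25: S′ a smooth affine curve through s, t); SGA1 (Exp. I §9, Exp. XII
Prop. 2.4); GrothendieckTopology1969 (§1, §9); DeligneHodgeIII1974 (Cor. 8.2.8); VoisinHodgeI2002 (§7.3.2 Remark 7.29, §11.1.2);
VoisinHodgeII2003 (§4.3.3 Thm. 4.24, §6.1.1); FultonYoungTableaux1997 (App. B §B.1 (5)–(7)); Fulton1998 (§1.7, Prop. 1.7, §19.2);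
HatcherAT2002 (§3.3 Prop. 3.38); Hartshorne1977 (II §3 base extension, I Prop. 1.5); Milne2020HodgeClassesAV (Prop. 1 p. 7);
Abdulali1994FamiliesAV ((1.1) p. 1122); MumfordGIT (Thm. 6.14).
-/

noncomputable section

set_option linter.dupNamespace false

namespace Summit.HodgeConjecture.HodgeConjecture.Ring2.AbelianAll

open CategoryTheory CategoryTheory.Limits AlgebraicGeometry MonoidalCategory CartesianMonoidalCategory
open Literature.AlgebraicGeometry Literature.AlgebraicGeometry.Motives
open Literature.AlgebraicGeometry.HodgeTheory
open Literature.AlgebraicTopology.SingularHomology (cupPairing cupPairing_flip cupProduct_gradedComm_holds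
  isPerfPair_cupPairing_of_field_holds)
open Literature.AlgebraicGeometry.Deligne1982 (cmLocus)
open Summit.HodgeConjecture.HodgeConjecture.Theorems (cupPairing_complexGysin_complexOrientationFamily
  isCompactAbelianPencil_familyPullback_snd mem_cmLocus_familyPullback_snd_iff)

variable {𝒳 S S' : SchemeOver ℂ} {d : ℕ} {f : 𝒳 ⟶ S}

/-! ## §1 Purity along finitely many fibres (part XXV-e's argument, for an arbitrary submodule) -/

/-- **PURITY ALONG FINITELY MANY FIBRES.** On a compact pencil of abelian `d`-folds `f : 𝒳 ⟶ S`, let `Good ≤ Hᵏ(𝒳)` be a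
submodule containing every Gysin image `j_{s*} x`, `x ∈ Hᵃ(X_s)`, `a + 2 = k`, of every fibre. Then every class of `Hᵏ(𝒳)`
dying off `f⁻¹T`, for a proper Zariski-closed `T ⊊ S`, lies in `Good`: `T` is a finite set of closed points, each underlying a
complex point; `f⁻¹T` is the disjoint union of the corresponding fibres; a class dying off ONE fibre is a Gysin image from it
(Thom–Gysin, `ker_restrictCompl_eq_iSup_range_complexGysin_of_isClosedImmersion`), and kernels of restrictions add up over
DISJOINT closed pieces (Mayer–Vietoris, `ker_restrictCompl_union_le`). [cite: DeligneHodgeIII1974, Cor. 8.2.8]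
[cite: VoisinHodgeII2003, §6.1.1 (Thom–Gysin)] [cite: GrothendieckTopology1969, §1] [cite: Hartshorne1977, Ch. I Prop. 1.5 and Ch. II §3] -/
theorem mem_of_restrictCompl_preimage_eq_zero_of_gysin_mem (hf : IsCompactAbelianPencil f d) {k : ℕ}
    (Good : Submodule ℂ (complexBetti 𝒳 k))
    (hgys : ∀ (s : ComplexPoints S) (a : ℕ) (hab : a + 2 * (d + 1) = k + 2 * d) (x : complexBetti (fiberOver f s) a),
      complexGysin complexOrientationFamily (hf.isSmoothProjective_fiberOver s) hf.isSmoothProjective_total (fiberι f s) hab x ∈ Good)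
    (T : Set S.left) (hT : IsClosed T) (hTu : T ≠ Set.univ) (u : complexBetti 𝒳 k)
    (hu : complexBetti.restrictCompl 𝒳 (f.left.base ⁻¹' T) k u = 0) : u ∈ Good := by
  classical
  have hX := hf.isSmoothProjective_total
  haveI : IsIntegral S.left := IsSmoothProjective.isIntegral_holds hf.isSmoothProjective_base
  haveI : SmoothOfRelativeDimension 1 S.hom := hf.isSmoothProjective_base.smoothOfRelativeDimension
  haveI : Smooth S.hom := SmoothOfRelativeDimension.smooth 1 _
  haveI : LocallyOfFiniteType S.hom := inferInstance
  haveI : IsProper S.hom := hf.isSmoothProjective_base.isProjectiveOver.isProper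
  haveI : IsSeparated S.hom := inferInstance
  haveI : IsLocallyNoetherian S.left := LocallyOfFiniteType.isLocallyNoetherian S.hom
  haveI : CompactSpace S.left := QuasiCompact.compactSpace_of_compactSpace S.hom
  haveI : IsNoetherian S.left := {}
  haveI : TopologicalSpace.NoetherianSpace S.left := inferInstance
  -- the fibres: `Z s = f⁻¹{s} = im j_s`
  let Z : ComplexPoints S → Set 𝒳.left := fun s ↦ Set.range (fiberι f s).left.base
  have hZc : ∀ s, IsClosed (Z s) := fun s ↦ by
    haveI := Motives.isClosedImmersion_fiberι_left f s
    exact (fiberι f s).left.isClosedEmbedding.isClosed_range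
  -- one fibre: Thom–Gysin purity
  have hone : ∀ s, LinearMap.ker (complexBetti.restrictCompl 𝒳 (Z s) k).hom ≤ Good := by
    intro s
    haveI := Motives.isClosedImmersion_fiberι_left f s
    rw [ker_restrictCompl_eq_iSup_range_complexGysin_of_isClosedImmersion complexOrientationFamily hX
      (hf.isSmoothProjective_fiberOver s) (fiberι f s) k]
    refine iSup₂_le fun a hab ↦ ?_
    rintro _ ⟨x, rfl⟩
    exact hgys s a hab x
  -- finitely many fibres: additivity of kernels over disjoint closed pieces
  have hfin : ∀ G : Finset (ComplexPoints S),
      LinearMap.ker (complexBetti.restrictCompl 𝒳 (⋃ s ∈ G, Z s) k).hom ≤ Good := by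
    intro G
    induction G using Finset.induction_on with
    | empty =>
      intro a ha
      have ha' : complexBetti.restrictCompl 𝒳 (⋃ s ∈ (∅ : Finset (ComplexPoints S)), Z s) k a = 0 := ha
      have he : (⋃ s ∈ (∅ : Finset (ComplexPoints S)), Z s) = (∅ : Set 𝒳.left) := by simp
      rw [he] at ha'
      have hinj := injective_restrictCompl_of_le_coheight hX isClosed_empty (c := k + 1)
        (fun z hz ↦ (Set.notMem_empty z hz).elim) (i := k) (by omega)
      have h0 : a = 0 := hinj (by rw [ha', map_zero])
      rw [h0]
      exact Submodule.zero_mem _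
    | insert s G hsG ih =>
      have hU : IsClosed (⋃ s' ∈ G, Z s') := G.finite_toSet.isClosed_biUnion fun s' _ ↦ hZc s'
      have he : (⋃ s' ∈ insert s G, Z s') = Z s ∪ ⋃ s' ∈ G, Z s' := by
        rw [Finset.set_biUnion_insert]
      rw [he]
      have hint : ∀ t ∈ Z s ∩ ⋃ s' ∈ G, Z s', ((k + 1 : ℕ) : ℕ∞) ≤ Order.coheight t := by
        rintro y ⟨hy, hy'⟩
        exfalso
        obtain ⟨s', hs'G, hys'⟩ := Set.mem_iUnion₂.1 hy'
        have h1 : f.left.base y = s.pt := (range_fiberι_base_eq_preimage f s).subset hy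
        have h2 : f.left.base y = s'.pt := (range_fiberι_base_eq_preimage f s').subset hys'
        have hss' : s = s' := Motives.ComplexPoints.ext_of_pt_eq (h1.symm.trans h2)
        exact hsG (hss' ▸ hs'G)
      calc LinearMap.ker (complexBetti.restrictCompl 𝒳 (Z s ∪ ⋃ s' ∈ G, Z s') k).hom
          ≤ LinearMap.ker (complexBetti.restrictCompl 𝒳 (Z s) k).hom ⊔
              LinearMap.ker (complexBetti.restrictCompl 𝒳 (⋃ s' ∈ G, Z s') k).hom :=
            ker_restrictCompl_union_le hX (hZc s) hU hint (by omega)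
        _ ≤ Good := sup_le (hone s) ih
  -- `f⁻¹T` lies in the union of the fibres over the finitely many complex points of `T`
  have hF : {t : ComplexPoints S | t.pt ∈ T}.Finite := finite_setOf_pt_mem_of_isClosed_of_ne_univ hT hTu
  have hsub : f.left.base ⁻¹' T ⊆ ⋃ s ∈ hF.toFinset, Z s := by
    intro y hy
    have hyT : f.left.base y ∈ T := hy
    have hne : f.left.base y ≠ ⊤ := fun h ↦ top_notMem_of_isClosed_of_ne_univ hT hTu (h ▸ hyT)
    obtain ⟨s, hs⟩ := AlgPoints.exists_pt_eq_of_isClosed (L := ℂ) (f.left.base y) (isClosed_singleton_of_ne_top hne)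
    refine Set.mem_iUnion₂.2 ⟨s, ?_, ?_⟩
    · rw [Set.Finite.mem_toFinset]
      change s.pt ∈ T
      rw [hs]; exact hyT
    · change y ∈ Set.range (fiberι f s).left.base
      rw [range_fiberι_base_eq_preimage]
      exact hs.symm
  have hmem : u ∈ LinearMap.ker (complexBetti.restrictCompl 𝒳 (⋃ s ∈ hF.toFinset, Z s) k).hom :=
    ker_restrictCompl_le_of_subset hsub k (show u ∈ LinearMap.ker (complexBetti.restrictCompl 𝒳 (f.left.base ⁻¹' T) k).hom from hu)
  exact hfin hF.toFinset hmem

/-! ## §2 The base change square and the engine: `G_*` of a class dying on the fibres of `f'` dies on the fibres of `f` -/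

section BaseChange

variable (hf : IsCompactAbelianPencil f d) (g : S' ⟶ S) [IsFinite g.left] [Etale g.left] [ConnectedSpace (ComplexPoints S')]

include hf in
/-- A finite étale cover with connected (hence non-empty) complex points of the irreducible base curve is SURJECTIVE
(b05's argument: locally constant rank `≥ 1`). [cite: SGA1, Exp. I §9 and Exp. XII Prop. 2.4] [cite: StacksProject, Tag 02KA] -/
theorem surjective_left_of_cover : Surjective g.left := by
  haveI := hf.isSmoothProjective_base.smoothOfRelativeDimension
  haveI hS'd : SmoothOfRelativeDimension 1 S'.hom := by
    have h : SmoothOfRelativeDimension (0 + 1) (g.left ≫ S.hom) := inferInstance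
    rw [Over.w] at h
    simpa using h
  haveI : Smooth S'.hom := SmoothOfRelativeDimension.smooth 1 _
  haveI : IrreducibleSpace S'.left := irreducibleSpace_left_of_connectedSpace_complexPoints
  haveI : Nonempty S'.left := inferInstance
  haveI : IrreducibleSpace S.left := hf.isSmoothProjective_base.irreducibleSpace
  exact surjective_of_isFinite_of_etale_of_irreducible g.left

include hf in
/-- The projection `G : 𝒳 ×_S S' ⟶ 𝒳` is surjective (base change of the surjective `g`). [cite: Hartshorne1977, II §3 (base extension)] -/
theorem surjective_familyPullback_fst_left : Surjective (familyPullback.fst f g).left := by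
  haveI := surjective_left_of_cover hf g
  rw [familyPullback.fst_left]
  exact MorphismProperty.pullback_fst (P := @Surjective) _ _ ‹Surjective g.left›

include hf in
/-- `g` is onto on complex points. [cite: SGA1, Exp. XII Prop. 2.4] -/
theorem exists_map_eq_of_cover (t : ComplexPoints S) : ∃ t' : ComplexPoints S', AlgPoints.map g t' = t := by
  haveI := surjective_left_of_cover hf g
  haveI := hf.isSmoothProjective_base.smoothOfRelativeDimension
  haveI hS'd : SmoothOfRelativeDimension 1 S'.hom := by
    have h : SmoothOfRelativeDimension (0 + 1) (g.left ≫ S.hom) := inferInstance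
    rw [Over.w] at h
    simpa using h
  haveI : Smooth S'.hom := SmoothOfRelativeDimension.smooth 1 _
  haveI : Smooth S.hom := SmoothOfRelativeDimension.smooth 1 _
  haveI : LocallyOfFiniteType S'.hom := inferInstance
  haveI : LocallyOfFiniteType S.hom := inferInstance
  exact AlgPoints.map_surjective_of_surjective g t

omit [IsFinite g.left] [Etale g.left] [ConnectedSpace (ComplexPoints S')] in
/-- **`G⁻¹(𝒳_t) = f'⁻¹(g⁻¹ t)`** as subsets of `𝒳 ×_S S'` (`G ≫ f = f' ≫ g` and `im j_t = f⁻¹ t`). [cite: Hartshorne1977, II §3] -/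
theorem preimage_fst_range_fiberι_eq (t : ComplexPoints S) :
    (familyPullback.fst f g).left.base ⁻¹' Set.range (fiberι f t).left.base =
      (familyPullback.snd f g).left.base ⁻¹' (g.left.base ⁻¹' {t.pt}) := by
  rw [range_fiberι_base_eq_preimage, ← Set.preimage_comp, ← Set.preimage_comp, ← TopCat.coe_comp, ← TopCat.coe_comp,
    ← Scheme.Hom.comp_base, ← Scheme.Hom.comp_base, ← Over.comp_left, ← Over.comp_left, familyPullback.condition]

include hf in
/-- `g⁻¹ t` is a PROPER closed subset of `S'`: `g` is onto the curve `S`, whose generic point is not the closed point `t`.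
[folklore] -/
theorem preimage_pt_ne_univ (t : ComplexPoints S) : g.left.base ⁻¹' {t.pt} ≠ Set.univ := by
  haveI := surjective_left_of_cover hf g
  haveI : IsIntegral S.left := IsSmoothProjective.isIntegral_holds hf.isSmoothProjective_base
  haveI : SmoothOfRelativeDimension 1 S.hom := hf.isSmoothProjective_base.smoothOfRelativeDimension
  intro h
  obtain ⟨s', hs'⟩ := ‹Surjective g.left›.surj (⊤ : S.left)
  have hmem : s' ∈ g.left.base ⁻¹' {t.pt} := h ▸ Set.mem_univ s'
  rw [Set.mem_preimage, Set.mem_singleton_iff, hs'] at hmem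
  exact pt_ne_top_of_smoothCurve t hmem.symm

include hf in
/-- **THE ENGINE: `G_*` of a class dying on the fibres of `f'` dies on the fibres of `f`.** For `κ' ∈ H²ᵖ(𝒳 ×_S S')`, `p ≤ d`,
with `j'^*_{s'} κ' = 0` for every `s'`, and every `t`: `j_t^*(G_* κ') = 0`. Proof by Poincaré duality on `X_t(ℂ)`: for
`α ∈ H^{2d−2p}(X_t)`, `⟨j_{t*} α, G_* κ'⟩_𝒳 = ± ⟨G_* κ', j_{t*} α⟩_𝒳 = ± ⟨κ', G^* j_{t*} α⟩_{𝒳×_S S'}` (graded commutativity,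
transposition), and `G^* j_{t*} α` dies off `G⁻¹(𝒳_t) = f'⁻¹(g⁻¹ t)` (`j_{t*} α` dies off `𝒳_t`), hence (§1) lies in the span of
the Gysin images `j'_{s'*} x` of the fibres of `f'`, each of which pairs to zero with `κ'`: `⟨κ', j'_{s'*} x⟩ = ± ⟨x, j'^*_{s'} κ'⟩ = 0`.
[cite: FultonYoungTableaux1997, Appendix B §B.1 (5)–(6)] [cite: HatcherAT2002, §3.3 Prop. 3.38] [cite: DeligneHodgeIII1974, Cor. 8.2.8]
[cite: GrothendieckTopology1969, §1] -/
theorem map_fiberι_complexGysin_fst_eq_zero {p : ℕ} (hp : p ≤ d) {κ' : complexBetti (familyPullback f g) (2 * p)}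
    (hκ' : ∀ s' : ComplexPoints S', complexBetti.map (fiberι (familyPullback.snd f g) s') (2 * p) κ' = 0)
    (t : ComplexPoints S) :
    complexBetti.map (fiberι f t) (2 * p)
      (complexGysin complexOrientationFamily (isCompactAbelianPencil_familyPullback_snd hf g).isSmoothProjective_total
        hf.isSmoothProjective_total (familyPullback.fst f g) rfl κ') = 0 := by
  have hf' := isCompactAbelianPencil_familyPullback_snd hf g
  have hX := hf.isSmoothProjective_total
  have hX' := hf'.isSmoothProjective_total
  have hXt := hf.isSmoothProjective_fiberOver t
  letI := hXt.chartedSpace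
  haveI := ComplexPoints.compactSpace_of_isSmoothProjective hXt
  haveI := ComplexPoints.t2Space_of_isSmoothProjective hXt
  -- degrees
  have haa : (2 * d - 2 * p) + 2 * p = 2 * d := by omega
  have hab : (2 * d - 2 * p) + 2 * (d + 1) = (2 * d - 2 * p + 2) + 2 * d := by omega
  have hbk : (2 * d - 2 * p + 2) + 2 * p = 2 * (d + 1) := by omega
  have hkb : 2 * p + (2 * d - 2 * p + 2) = 2 * (d + 1) := by omega
  -- Poincaré duality on the fibre: it suffices to pair with every `α`
  have hPerf : (cupPairing (complexOrientationFamily hXt) haa).IsPerfPair := isPerfPair_cupPairing_of_field_holds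
  refine (LinearMap.IsPerfPair.bijective_right (cupPairing (complexOrientationFamily hXt) haa)).1 ?_
  rw [map_zero]
  ext α
  rw [LinearMap.flip_apply, LinearMap.zero_apply,
    ← cupPairing_complexGysin_complexOrientationFamily (fiberι f t) hX hXt hab haa hbk α _]
  -- transpose on `𝒳`: `⟨j_{t*} α, G_* κ'⟩ = ± ⟨G_* κ', j_{t*} α⟩ = ± ⟨κ', G^* j_{t*} α⟩`
  have hflip := congrArg (fun φ ↦ φ (complexGysin complexOrientationFamily hX' hX (familyPullback.fst f g) rfl κ')
      (complexGysin complexOrientationFamily hXt hX (fiberι f t) hab α))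
    (cupPairing_flip (cupProduct_gradedComm_holds ℂ (ComplexPoints 𝒳)) (complexOrientationFamily hX) hbk hkb)
  simp only [LinearMap.flip_apply, LinearMap.smul_apply] at hflip
  rw [hflip, cupPairing_complexGysin_complexOrientationFamily (familyPullback.fst f g) hX hX' rfl hkb hkb κ' _]
  -- `G^* j_{t*} α` dies off `f'⁻¹(g⁻¹ t)`, hence lies in `Good = {v | ⟨κ', v⟩ = 0}`
  set Good : Submodule ℂ (complexBetti (familyPullback f g) (2 * d - 2 * p + 2)) :=
    LinearMap.ker (cupPairing (complexOrientationFamily hX') hkb κ') with hGood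
  have hdies : complexBetti.restrictCompl (familyPullback f g)
      ((familyPullback.snd f g).left.base ⁻¹' (g.left.base ⁻¹' {t.pt})) (2 * d - 2 * p + 2)
      (complexBetti.map (familyPullback.fst f g) (2 * d - 2 * p + 2)
        (complexGysin complexOrientationFamily hXt hX (fiberι f t) hab α)) = 0 := by
    rw [← preimage_fst_range_fiberι_eq g t]
    refine complexBetti.restrictCompl_map_eq_zero (familyPullback.fst f g) ?_
    haveI : IsProper S.hom := IsSmoothProjective.isProper_holds hf.isSmoothProjective_base
    haveI := Motives.isClosedImmersion_fiberι_left f t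
    exact restrictCompl_complexGysin_eq_zero
      (Literature.AlgebraicTopology.SingularHomology.gysinMap_restrictCompl_eq_zero_of_field ℂ) complexOrientationFamily
      (OrientationFamily.hasPoincareDuality _) hX hXt (fiberι f t) (fiberι f t).left.isClosedEmbedding.isClosed_range
      subset_rfl hab α
  have hgood : complexBetti.map (familyPullback.fst f g) (2 * d - 2 * p + 2)
      (complexGysin complexOrientationFamily hXt hX (fiberι f t) hab α) ∈ Good := by
    refine mem_of_restrictCompl_preimage_eq_zero_of_gysin_mem hf' Good (fun s' a hab' x ↦ ?_) _
      ((ComplexPoints.isClosed_pt t).preimage g.left.continuous) (preimage_pt_ne_univ hf g t) _ hdies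
    -- the Gysin images of the fibres of `f'` pair to zero with `κ'`
    have hXs' := hf'.isSmoothProjective_fiberOver s'
    rw [hGood, LinearMap.mem_ker]
    have hk' : a + 2 * p = 2 * d := by omega
    have hflip' := congrArg (fun φ ↦ φ
        (complexGysin complexOrientationFamily hXs' hX' (fiberι (familyPullback.snd f g) s') hab' x) κ')
      (cupPairing_flip (cupProduct_gradedComm_holds ℂ (ComplexPoints (familyPullback f g))) (complexOrientationFamily hX') hkb hbk)
    simp only [LinearMap.flip_apply, LinearMap.smul_apply] at hflip'
    rw [hflip', cupPairing_complexGysin_complexOrientationFamily (fiberι (familyPullback.snd f g) s') hX' hXs' hab' hk'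
      hbk x κ', hκ' s', map_zero, smul_zero]
  rw [hGood, LinearMap.mem_ker] at hgood
  rw [hgood, smul_zero]

end BaseChange

end Summit.HodgeConjecture.HodgeConjecture.Ring2.AbelianAll

end
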